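import Summits.QuantumFields.BalabanUV.Beta.AxialCoordinateProjectorBm

/-!
# The COARSE axial coordinate projector `axEc` — the multiplier block of `E` must live on the `N`-coarse sublattice
# (β sub-cell, row BETA-an2, gen 13; NOTE X-an2-43: the sockets h3/h4 of the gen-12 wiring theorems are unsatisfiable as typed; file 1 of 2)

HONEST FRAMING (cell charter, verbatim): «discharging BetaPertH makes Balaban's UV stability UNCONDITIONAL — a real
constructive-QFT result; it is NOT the continuum limit and NOT the Clay problem.»  DERIVED cell leaf (pub-balaban β sub-cell, lane
an2 gen 13); no statement of Bałaban's papers is typed here, no `[cite:]` tag, no `Prop` fact; it instantiates no binder of the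
β-function wall by itself.  NOT `BetaPertH`; NOT continuum; NOT Clay.

## What is here

The relative-inverse sockets `ChartConjugationRelative.RelInv G_j 𝕄 E` of the centred dressed spine were instantiated (gen 12,
`AxialCoordinateProjector`, `SpineRootedReflectionWiring`, `SpineRootedBm`) with `E := axE ρ Lc`, whose MULTIPLIER block is the
identity at EVERY lattice site.  But the packed resolvents carry their multiplier legs on the coarse sublattice only: every
`KInvStep Lc j` — hence every co-dressed `G_j = coDressK[Bm]At ρ Lc (KInvStep Lc j)` — has zero multiplier rows AND columns off the
`Lc`-coarse points.  Consequently, for `Lc ≥ 2`, rules 3–4 `(G_j∘𝕄)∘E = E`, `(E∘𝕄)∘G_j = E` are UNSATISFIABLE for every `𝕄`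
(§2: the column / row `(inr 0, e₀)` of the left-hand side vanishes, that of `axE` is `1`) — the gen-12 wiring theorems are vacuously
true as typed.  The repair is to let `E` project the multiplier block onto the coarse sublattice:
* §1 support of the packed resolvents on the multiplier legs (`KInv_inr_right_off`, `dec_inr_right`, `KInvStep_inr_off'` — the
  COLUMN twin of `OneStepKernelFamily.KInvStep_inr_off` —, `comp_inr_col_eq_zero` / `comp_inr_row_eq_zero`, and the co-dressed rows /
  columns `coDressKBmAt_KInvStep_inr_row_off` / `_col_off`, `coDressKAt_KInvStep_inr_col_off`);
* §2 the VACUITY theorems for the old sockets: `comp_comp_axE_coDressKBmAt_ne`, `comp_comp_coDressKBmAt_ne_axE` (block-mean dressing),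
  `comp_comp_axE_coDressKAt_ne` (comb-root dressing);
* §3 **`axEc ρ N`** — field block the diagonal indicator of NON-comb bonds (as `axE`), multiplier block the diagonal indicator of the
  COARSE sites; entries, `decays_axEc`, `spr_axEc`, `trK_axEc`, the left / right action lemmas `comp_axEc_apply`, `comp_axEc_apply'`.
File 2 (`AxialCoordinateProjectorCoarseRules`): `piKBmC` and RULES 1–2 for the repaired projector.  Rules 3–4 at `j = 0` against the
undressed bordered Hessian: `RelInvBorderedHessian` (same lane, gen 13).

All declarations `[folklore]` (finite sums, support bookkeeping); axioms standard.
Provenance: b2b-balaban β sub-cell, unit beta-an2 gen 13, 2026-08-20 (v1); over `AxialCoordinateProjector(Bm)`, `AxialDressingRootedBmKernel`,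
`OneStepKernelFamily` BY NAME; no existing file touched.
-/
open Finset
open scoped BigOperators
open Literature.Probability.LatticeModels (TorusSite Torus.proj Torus.proj_apply)
open Literature.MathematicalPhysics.QuantumFieldTheory
open Literature.MathematicalPhysics.QuantumFieldTheory.Balaban1983to89
open Literature.MathematicalPhysics.QuantumFieldTheory.Balaban1983to89.Beta
open B12Sec2to5 (l1 l1_nonneg)
open ExpKernelCalculus (MKer Decays BiLoc comp tr shiftK)
open AffineAveraging (Form0 Form1 box toSite unitVec unitVec_apply)
open OneStepResolventKernel (Fib KInv)
open OneStepKernelFamily (KInvStep dec legSet legPt legW decays_KInvStep KInvStep_inr_off proj_pow_smul_eq_zero_iff)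
open Summit.QuantumFields.BalabanUV.Beta.TameKernelCalculus

namespace Summit.QuantumFields.BalabanUV.Beta.AxialDressingRooted

noncomputable section

variable {d : ℕ}

/-! ## §1 Support of the packed resolvents on the multiplier legs -/

section Support

/-- [folklore] The SECOND multiplier leg of `KInv` vanishes off the coarse sublattice (both fibre rows). -/
theorem KInv_inr_right_off {N : ℕ} [NeZero N] {y : Fin (d + 1) → ℤ} (hy : Torus.proj N y ≠ 0) (x : Fin (d + 1) → ℤ) (a : Fib d)
    (κ : Fin (d + 1)) : KInv (N := N) x y a (Sum.inr κ) = 0 := by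
  rcases a with l | l
  · exact OneStepResolventKernel.KInv_inl_inr_off hy l κ x
  · simp only [KInv, hy, and_false, if_false]

/-- [folklore] Multiplier COLUMNS of the decimated kernel vanish wherever the fine kernel's multiplier columns vanish at `M•y′`. -/
theorem dec_inr_right (M : ℕ) (K : MKer (d + 1) (Fib d)) (a : Fib d) (κ : Fin (d + 1)) (x' y' : Fin (d + 1) → ℤ)
    (hK : ∀ p, K p ((M : ℤ) • y') a (Sum.inr κ) = 0) : dec M K x' y' a (Sum.inr κ) = 0 := by
  simp only [dec, legSet, legPt, hK, mul_zero, Finset.sum_const_zero]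

/-- [folklore] Multiplier COLUMNS of `KInvStep Lc j` vanish off the `Lc`-coarse points of the step-`j` lattice (twin of
`OneStepKernelFamily.KInvStep_inr_off`, which is the ROW statement). -/
theorem KInvStep_inr_off' {Lc : ℕ} [NeZero Lc] (j : ℕ) {y' : Fin (d + 1) → ℤ} (hy : Torus.proj Lc y' ≠ 0) (x' : Fin (d + 1) → ℤ)
    (a : Fib d) (κ : Fin (d + 1)) : KInvStep (d := d) Lc j x' y' a (Sum.inr κ) = 0 := by
  refine dec_inr_right _ _ a κ x' y' (fun p => KInv_inr_right_off (N := Lc ^ (j + 1)) ?_ p a κ)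
  rwa [Ne, proj_pow_smul_eq_zero_iff]

/-- [folklore] A composition inherits vanishing multiplier COLUMNS from its right factor (termwise; no summability needed). -/
theorem comp_inr_col_eq_zero (A G : MKer (d + 1) (Fib d)) {z : Fin (d + 1) → ℤ} {m : Fin (d + 1)}
    (hG : ∀ y f, G y z f (Sum.inr m) = 0) (x : Fin (d + 1) → ℤ) (a : Fib d) : comp A G x z a (Sum.inr m) = 0 := by
  unfold ExpKernelCalculus.comp
  simp [hG]

/-- [folklore] A composition inherits vanishing multiplier ROWS from its left factor (termwise). -/
theorem comp_inr_row_eq_zero (G B : MKer (d + 1) (Fib d)) {x : Fin (d + 1) → ℤ} {m : Fin (d + 1)}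
    (hG : ∀ y f, G x y (Sum.inr m) f = 0) (z : Fin (d + 1) → ℤ) (b : Fib d) : comp G B x z (Sum.inr m) b = 0 := by
  unfold ExpKernelCalculus.comp
  simp [hG]

variable (ρ : Fin (d + 1) → ℤ) {Lc : ℕ} [NeZero Lc]

/-- [folklore] Multiplier COLUMNS of the block-mean co-dressed resolvent `Π·KInvStep_j·Πᵀ` vanish off the coarse sublattice. -/
theorem coDressKBmAt_KInvStep_inr_col_off (j : ℕ) {z : Fin (d + 1) → ℤ} (hz : Torus.proj Lc z ≠ 0) (x : Fin (d + 1) → ℤ)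
    (a : Fib d) (m : Fin (d + 1)) : coDressKBmAt ρ Lc (KInvStep (d := d) Lc j) x z a (Sum.inr m) = 0 := by
  rw [coDressKBmAt_eq, comp_piKBm_inr]
  exact comp_inr_col_eq_zero _ _ (fun y f => KInvStep_inr_off' j hz y f m) x a

/-- [folklore] Multiplier ROWS of the block-mean co-dressed resolvent vanish off the coarse sublattice. -/
theorem coDressKBmAt_KInvStep_inr_row_off (j : ℕ) {x : Fin (d + 1) → ℤ} (hx : Torus.proj Lc x ≠ 0) (z : Fin (d + 1) → ℤ)
    (m : Fin (d + 1)) (b : Fib d) : coDressKBmAt ρ Lc (KInvStep (d := d) Lc j) x z (Sum.inr m) b = 0 := by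
  rw [coDressKBmAt_eq]
  refine comp_inr_row_eq_zero _ _ (fun y f => ?_) z b
  -- the row `(inr m, x)` of `Πᵀ-kernelᵀ ∘ K` is the row of `K`
  unfold ExpKernelCalculus.comp
  have h : ∀ u, ∑ g : Fib d, trK (piKBm ρ Lc) x u (Sum.inr m) g * KInvStep (d := d) Lc j u y g f = 0 := by
    intro u
    rw [Fintype.sum_sum_type]
    simp only [trK_apply, piKBm_inl_inr, zero_mul, Finset.sum_const_zero, zero_add, piKBm_inr_inr]
    refine Finset.sum_eq_zero fun m' _ => ?_
    split_ifs with h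
    · rw [h.1, KInvStep_inr_off j hx]; ring
    · rw [zero_mul]
  simp_rw [h]
  exact tsum_zero

/-- [folklore] Multiplier COLUMNS of the comb-root co-dressed resolvent `coDressKAt` vanish off the coarse sublattice too. -/
theorem coDressKAt_KInvStep_inr_col_off (j : ℕ) {z : Fin (d + 1) → ℤ} (hz : Torus.proj Lc z ≠ 0) (x : Fin (d + 1) → ℤ)
    (a : Fib d) (m : Fin (d + 1)) : coDressKAt ρ Lc (KInvStep (d := d) Lc j) x z a (Sum.inr m) = 0 := by
  rw [coDressKAt_eq, comp_piK_inr]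
  exact comp_inr_col_eq_zero _ _ (fun y f => KInvStep_inr_off' j hz y f m) x a

end Support

/-! ## §2 The old sockets are unsatisfiable: `axE` is the identity on ALL multiplier sites -/

section Vacuity

variable {Lc : ℕ} [NeZero Lc]

omit [NeZero Lc] in
/-- [folklore] For `Lc ≥ 2` the unit vector `e₀` is NOT a coarse point. -/
theorem proj_unitVec_ne_zero (hLc : 2 ≤ Lc) : Torus.proj Lc (unitVec (0 : Fin (d + 1))) ≠ 0 := by
  intro h
  have h0 := congr_fun h 0
  simp only [Torus.proj_apply, unitVec_apply, if_true, Int.cast_one, Pi.zero_apply] at h0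
  haveI : Fact (1 < Lc) := ⟨hLc⟩
  exact one_ne_zero h0

/-- [folklore] **RULE 4 WITH `axE` IS UNSATISFIABLE** (block-mean dressing): for `Lc ≥ 2`, every `𝕄`, every root, every `j`,
`(axE∘𝕄)∘G_j ≠ axE` — the column `(inr 0, e₀)` of the left side is `0`, that of `axE` is `1`. -/
theorem comp_comp_axE_coDressKBmAt_ne (hLc : 2 ≤ Lc) (ρ ρ' : Fin (d + 1) → ℤ) (M : MKer (d + 1) (Fib d)) (j : ℕ) :
    comp (comp (axE ρ' Lc) M) (coDressKBmAt ρ Lc (KInvStep (d := d) Lc j)) ≠ axE ρ' Lc := by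
  intro h
  have hz := proj_unitVec_ne_zero (d := d) hLc
  have h1 := congr_fun (congr_fun (congr_fun (congr_fun h (unitVec 0)) (unitVec 0)) (Sum.inr 0)) (Sum.inr 0)
  rw [comp_inr_col_eq_zero _ _ (fun y f => coDressKBmAt_KInvStep_inr_col_off ρ j hz y f 0), axE_inr_inr,
    if_pos ⟨rfl, rfl⟩] at h1
  exact zero_ne_one h1

/-- [folklore] **RULE 3 WITH `axE` IS UNSATISFIABLE** (block-mean dressing): `(G_j∘𝕄)∘axE ≠ axE` for `Lc ≥ 2`. -/
theorem comp_comp_coDressKBmAt_ne_axE (hLc : 2 ≤ Lc) (ρ ρ' : Fin (d + 1) → ℤ) (M : MKer (d + 1) (Fib d)) (j : ℕ) :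
    comp (comp (coDressKBmAt ρ Lc (KInvStep (d := d) Lc j)) M) (axE ρ' Lc) ≠ axE ρ' Lc := by
  intro h
  have hz := proj_unitVec_ne_zero (d := d) hLc
  have h1 := congr_fun (congr_fun (congr_fun (congr_fun h (unitVec 0)) (unitVec 0)) (Sum.inr 0)) (Sum.inr 0)
  rw [comp_inr_row_eq_zero _ _ (fun y f => comp_inr_row_eq_zero _ _
      (fun y' f' => coDressKBmAt_KInvStep_inr_row_off ρ j hz y' 0 f') y f), axE_inr_inr, if_pos ⟨rfl, rfl⟩] at h1
  exact zero_ne_one h1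

/-- [folklore] **RULE 4 WITH `axE` IS UNSATISFIABLE** for the comb-root dressing `coDressKAt` as well. -/
theorem comp_comp_axE_coDressKAt_ne (hLc : 2 ≤ Lc) (ρ ρ' : Fin (d + 1) → ℤ) (M : MKer (d + 1) (Fib d)) (j : ℕ) :
    comp (comp (axE ρ' Lc) M) (coDressKAt ρ Lc (KInvStep (d := d) Lc j)) ≠ axE ρ' Lc := by
  intro h
  have hz := proj_unitVec_ne_zero (d := d) hLc
  have h1 := congr_fun (congr_fun (congr_fun (congr_fun h (unitVec 0)) (unitVec 0)) (Sum.inr 0)) (Sum.inr 0)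
  rw [comp_inr_col_eq_zero _ _ (fun y f => coDressKAt_KInvStep_inr_col_off ρ j hz y f 0), axE_inr_inr,
    if_pos ⟨rfl, rfl⟩] at h1
  exact zero_ne_one h1

end Vacuity

/-! ## §3 The coarse axial coordinate projector `axEc ρ N` -/

section AxEc

open Classical in
/-- [folklore] **THE COARSE AXIAL COORDINATE PROJECTOR KERNEL** `axEc ρ N`: on the field block the diagonal indicator of the NON-comb
bonds (as `axE`); on the multiplier block the diagonal indicator of the COARSE sites `proj N x = 0` (where the packed resolvents carry
their multiplier legs); mixed blocks zero. -/
def axEc (ρ : Fin (d + 1) → ℤ) (N : ℕ) : MKer (d + 1) (Fib d) :=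
  fun x x' a b =>
    match a, b with
    | Sum.inl α, Sum.inl β => if x = x' ∧ α = β ∧ ¬ IsCombBondAt ρ N α x then 1 else 0
    | Sum.inl _, Sum.inr _ => 0
    | Sum.inr _, Sum.inl _ => 0
    | Sum.inr m, Sum.inr m' => if x = x' ∧ m = m' ∧ Torus.proj N x = 0 then 1 else 0

variable (ρ : Fin (d + 1) → ℤ) (N : ℕ)

open Classical in
/-- [folklore] Field–field entry of `axEc` (= that of `axE`). -/
theorem axEc_inl_inl (x x' : Fin (d + 1) → ℤ) (α β : Fin (d + 1)) :
    axEc ρ N x x' (Sum.inl α) (Sum.inl β) = if x = x' ∧ α = β ∧ ¬ IsCombBondAt ρ N α x then 1 else 0 := rfl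

/-- [folklore] The field blocks of `axEc` and `axE` agree. -/
theorem axEc_inl_inl_eq_axE (x x' : Fin (d + 1) → ℤ) (α β : Fin (d + 1)) :
    axEc ρ N x x' (Sum.inl α) (Sum.inl β) = axE ρ N x x' (Sum.inl α) (Sum.inl β) := rfl

/-- [folklore] Field–multiplier entry of `axEc` vanishes. -/
theorem axEc_inl_inr (x x' : Fin (d + 1) → ℤ) (α m : Fin (d + 1)) : axEc ρ N x x' (Sum.inl α) (Sum.inr m) = 0 := rfl

/-- [folklore] Multiplier–field entry of `axEc` vanishes. -/
theorem axEc_inr_inl (x x' : Fin (d + 1) → ℤ) (m α : Fin (d + 1)) : axEc ρ N x x' (Sum.inr m) (Sum.inl α) = 0 := rfl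

/-- [folklore] Multiplier–multiplier entry of `axEc`: the diagonal indicator of the coarse sites. -/
theorem axEc_inr_inr (x x' : Fin (d + 1) → ℤ) (m m' : Fin (d + 1)) :
    axEc ρ N x x' (Sum.inr m) (Sum.inr m') = if x = x' ∧ m = m' ∧ Torus.proj N x = 0 then 1 else 0 := rfl

/-- [folklore] `axEc` is diagonal with entries in `{0, 1}`: it decays at EVERY rate with constant `1`. -/
theorem decays_axEc (δ : ℝ) : Decays (axEc ρ N) 1 δ := by
  intro x x' a b
  have hdiag : x = x' → (1 : ℝ) * Real.exp (-δ * l1 (x - x')) = 1 := fun h => by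
    subst h
    have h0 : l1 (0 : Fin (d + 1) → ℤ) = 0 := by simp [l1]
    rw [sub_self, h0, mul_zero, Real.exp_zero, mul_one]
  have hpos : (0 : ℝ) ≤ 1 * Real.exp (-δ * l1 (x - x')) := by positivity
  rcases a with α | m <;> rcases b with β | m'
  · rw [axEc_inl_inl]
    split_ifs with h
    · rw [hdiag h.1, abs_one]
    · rw [abs_zero]; exact hpos
  · rw [axEc_inl_inr, abs_zero]; exact hpos
  · rw [axEc_inr_inl, abs_zero]; exact hpos
  · rw [axEc_inr_inr]
    split_ifs with h
    · rw [hdiag h.1, abs_one]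
    · rw [abs_zero]; exact hpos

/-- [folklore] `axEc` is spread. -/
theorem spr_axEc : Spr (axEc ρ N) := ⟨1, 1, one_pos, decays_axEc ρ N 1⟩

/-- [folklore] `axEc` is symmetric. -/
theorem trK_axEc : trK (axEc ρ N) = axEc ρ N := by
  funext x x' a b
  rw [trK_apply]
  rcases a with α | m <;> rcases b with β | m'
  · rw [axEc_inl_inl, axEc_inl_inl]
    by_cases h : x = x' ∧ α = β
    · obtain ⟨rfl, rfl⟩ := h; rfl
    · rw [if_neg (fun h' => h ⟨h'.1.symm, h'.2.1.symm⟩), if_neg (fun h' => h ⟨h'.1, h'.2.1⟩)]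
  · rfl
  · rfl
  · rw [axEc_inr_inr, axEc_inr_inr]
    by_cases h : x = x' ∧ m = m'
    · obtain ⟨rfl, rfl⟩ := h; rfl
    · rw [if_neg (fun h' => h ⟨h'.1.symm, h'.2.1.symm⟩), if_neg (fun h' => h ⟨h'.1, h'.2.1⟩)]

open Classical in
/-- [folklore] LEFT ACTION of `axEc`: it kills the comb rows of the field block and the non-coarse rows of the multiplier block. -/
theorem comp_axEc_apply (X : MKer (d + 1) (Fib d)) (x x' : Fin (d + 1) → ℤ) (a b : Fib d) :
    comp (axEc ρ N) X x x' a b =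
      match a with
      | Sum.inl α => if IsCombBondAt ρ N α x then 0 else X x x' a b
      | Sum.inr _ => if Torus.proj N x = 0 then X x x' a b else 0 := by
  unfold ExpKernelCalculus.comp
  rcases a with α | m
  · have h : ∀ y, ∑ f : Fib d, axEc ρ N x y (Sum.inl α) f * X y x' f b =
        if x = y then (if IsCombBondAt ρ N α x then 0 else X y x' (Sum.inl α) b) else 0 := by
      intro y
      rw [Fintype.sum_sum_type]
      simp only [axEc_inl_inr, zero_mul, Finset.sum_const_zero, add_zero]
      rw [Finset.sum_eq_single α (fun β _ hβ => by rw [axEc_inl_inl, if_neg (fun h => hβ h.2.1.symm), zero_mul])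
        (fun h => absurd (Finset.mem_univ _) h), axEc_inl_inl]
      by_cases hy : x = y
      · by_cases hc : IsCombBondAt ρ N α x
        · rw [if_neg (fun h => h.2.2 hc), zero_mul, if_pos hy, if_pos hc]
        · rw [if_pos ⟨hy, rfl, hc⟩, one_mul, if_pos hy, if_neg hc]
      · rw [if_neg (fun h => hy h.1), zero_mul, if_neg hy]
    simp_rw [h]
    rw [tsum_point]
  · have h : ∀ y, ∑ f : Fib d, axEc ρ N x y (Sum.inr m) f * X y x' f b =
        if x = y then (if Torus.proj N x = 0 then X y x' (Sum.inr m) b else 0) else 0 := by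
      intro y
      rw [Fintype.sum_sum_type]
      simp only [axEc_inr_inl, zero_mul, Finset.sum_const_zero, zero_add]
      rw [Finset.sum_eq_single m (fun m' _ hm' => by rw [axEc_inr_inr, if_neg (fun h => hm' h.2.1.symm), zero_mul])
        (fun h => absurd (Finset.mem_univ _) h), axEc_inr_inr]
      by_cases hy : x = y
      · by_cases hc : Torus.proj N x = 0
        · rw [if_pos ⟨hy, rfl, hc⟩, one_mul, if_pos hy, if_pos hc]
        · rw [if_neg (fun h => hc h.2.2), zero_mul, if_pos hy, if_neg hc]
      · rw [if_neg (fun h => hy h.1), zero_mul, if_neg hy]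
    simp_rw [h]
    rw [tsum_point]

open Classical in
/-- [folklore] RIGHT ACTION of `axEc`: it kills the comb columns of the field block and the non-coarse columns of the multiplier block. -/
theorem comp_axEc_apply' (X : MKer (d + 1) (Fib d)) (x x' : Fin (d + 1) → ℤ) (a b : Fib d) :
    comp X (axEc ρ N) x x' a b =
      match b with
      | Sum.inl β => if IsCombBondAt ρ N β x' then 0 else X x x' a b
      | Sum.inr _ => if Torus.proj N x' = 0 then X x x' a b else 0 := by
  unfold ExpKernelCalculus.comp
  rcases b with β | m
  · have h : ∀ y, ∑ f : Fib d, X x y a f * axEc ρ N y x' f (Sum.inl β) =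
        if y = x' then (if IsCombBondAt ρ N β x' then 0 else X x y a (Sum.inl β)) else 0 := by
      intro y
      rw [Fintype.sum_sum_type]
      simp only [axEc_inr_inl, mul_zero, Finset.sum_const_zero, add_zero]
      rw [Finset.sum_eq_single β (fun β' _ hβ => by rw [axEc_inl_inl, if_neg (fun h => hβ h.2.1), mul_zero])
        (fun h => absurd (Finset.mem_univ _) h), axEc_inl_inl]
      by_cases hy : y = x'
      · have hcc : IsCombBondAt ρ N β y ↔ IsCombBondAt ρ N β x' := by rw [hy]
        by_cases hc : IsCombBondAt ρ N β x'
        · rw [if_neg (fun h => h.2.2 (hcc.2 hc)), mul_zero, if_pos hy, if_pos hc]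
        · rw [if_pos ⟨hy, rfl, fun h' => hc (hcc.1 h')⟩, mul_one, if_pos hy, if_neg hc]
      · rw [if_neg (fun h => hy h.1), mul_zero, if_neg hy]
    simp_rw [h]
    rw [tsum_point']
  · have h : ∀ y, ∑ f : Fib d, X x y a f * axEc ρ N y x' f (Sum.inr m) =
        if y = x' then (if Torus.proj N x' = 0 then X x y a (Sum.inr m) else 0) else 0 := by
      intro y
      rw [Fintype.sum_sum_type]
      simp only [axEc_inl_inr, mul_zero, Finset.sum_const_zero, zero_add]
      rw [Finset.sum_eq_single m (fun m' _ hm' => by rw [axEc_inr_inr, if_neg (fun h => hm' h.2.1), mul_zero])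
        (fun h => absurd (Finset.mem_univ _) h), axEc_inr_inr]
      by_cases hy : y = x'
      · have hcc : Torus.proj N y = 0 ↔ Torus.proj N x' = 0 := by rw [hy]
        by_cases hc : Torus.proj N x' = 0
        · rw [if_pos ⟨hy, rfl, hcc.2 hc⟩, mul_one, if_pos hy, if_pos hc]
        · rw [if_neg (fun h => hc (hcc.1 h.2.2)), mul_zero, if_pos hy, if_neg hc]
      · rw [if_neg (fun h => hy h.1), mul_zero, if_neg hy]
    simp_rw [h]
    rw [tsum_point']

end AxEc


end

end Summit.QuantumFields.BalabanUV.Beta.AxialDressingRooted
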